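import Mathlib
import Summits.AtomisticToContinuum.HydrodynamicLimit.Theorems.ImplosionDichotomyDenseExcursionCavityMatchingGlue
import Summits.AtomisticToContinuum.HydrodynamicLimit.Theorems.ImplosionDichotomyDenseExcursionCavityCentreRBranchUniform

/-!
# The centre-regular branch with a uniform weighted bound (theorem T7(i), brick (α) `centre_branch_bound`)
# (crux `DenseExcursion`, line `sonic-cavity-renewal`, brick for stub `stub_cavityResolventCk`)

Helper file (`--supports stmt-AtomisticToContinuum-12586`, line lead a2, stub-worker E2 for `stub_cavityResolventCk`).
Registered helper `centre_branch_bound` — the quantitative form of `centre_regular_solution` / `centre_regular_branch`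
(theorem T3) that theorem T7(i) consumes: for a monatomic profile in the cavity tube, `X > 0` and a bound `R₀` there is ONE
constant `Cc` such that for every `Λ` with `‖Λ‖ ≤ R₀`, every regular source `(f, g)` with weighted sup
`‖f(y)‖ + eʸ‖g(y)‖ ≤ N` on `y ≤ −X` and every `c₀ : ℂ` there is a REGULAR pair solving `Λŵ − linW = f`, `Λŝ − linS = g`
on `x ≤ −X`, NORMALISED AT THE CENTRE by `eʸ ŝ(y) → c₀` (`y → −∞`), with

  `‖ŵ(y)‖ + eʸ‖ŝ(y)‖ ≤ Cc (‖c₀‖ + N)`   on `y ≤ −X`.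

(`c₀ = 0`: the canonical particular solution, E1 §4 (α) verbatim; `f = g = 0`, `c₀ = 1`: the canonical homogeneous branch,
non-trivial by its normalisation, bounded uniformly in `Λ`.) Construction as in `centre_regular_solution` with the
uniform branch `centre_R_branch_uniform` in the signed radius (radius `δ` and constant uniform on `‖Λ‖ ≤ R₀`, weighted
bound on `eʸ ≤ δ/2` from the sources on the same half-line), even extension and regularity of the germ pair, glue with the
regular transport on `[log(δ/2) − 1, −X/2]` (`glue_solutions`, smooth cut-off `regularize_cutoff`), and the transport
ESTIMATE `transport_segment` on `[log(δ/2) − 1, −X]` (constant `K e^{K R₀}`, segment fixed since `δ` is uniform).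
Sources: folklore.
-/

noncomputable section

open Set Filter
open scoped Topology ContDiff

namespace Summit.AtomisticToContinuum.HydrodynamicLimit.Theorems.SonicCavityRenewal

open Summit.AtomisticToContinuum.HydrodynamicLimit.Theorems.R2OneModeTwoConditions
open Literature.MathematicalPhysics.KineticTheory (V3)

/-- EVEN SMOOTH EXTENSION from evenness on `(−δ, δ)` only: a function smooth on `(−δ, δ)` and even there agrees on
`[−δ/2, δ/2]` with a globally smooth EVEN function. [folklore] -/
theorem exists_even_contDiff_eq_of_evenOn {u : ℝ → ℂ} {δ : ℝ} (hδ : 0 < δ) (hu : ContDiffOn ℝ ∞ u (Ioo (-δ) δ))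
    (heven : ∀ R ∈ Ioo (-δ) δ, u (-R) = u R) :
    ∃ v : ℝ → ℂ, ContDiff ℝ ∞ v ∧ (∀ R, v (-R) = v R) ∧ ∀ R, |R| ≤ δ / 2 → v R = u R := by
  obtain ⟨g, hg, hgu⟩ := exists_contDiff_eq_on_Icc (n := ⊤) (r := δ / 2) (by linarith) (by linarith) hu
  refine ⟨fun R => (g R + g (-R)) / 2, (hg.add (hg.comp contDiff_neg)).div_const 2, fun R => by
    simp only [neg_neg]; ring, fun R hR => ?_⟩
  have h1 : R ∈ Icc (-(δ / 2)) (δ / 2) := ⟨by linarith [(abs_le.1 hR).1], (abs_le.1 hR).2⟩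
  have h2 : -R ∈ Icc (-(δ / 2)) (δ / 2) := ⟨by linarith [(abs_le.1 hR).2], by linarith [(abs_le.1 hR).1]⟩
  have hRI : R ∈ Ioo (-δ) δ := ⟨by linarith [(abs_le.1 hR).1], by linarith [(abs_le.1 hR).2]⟩
  simp only [hgu h1, hgu h2, heven R hRI]
  ring

/-- **Registered helper `centre_branch_bound` (T7(i) (α)): THE CENTRE-REGULAR BRANCH WITH A UNIFORM WEIGHTED BOUND AND
THE CENTRE NORMALISATION `eʸŝ(y) → c₀`.** See the module docstring. [folklore] -/
theorem centre_branch_bound : ∀ (r : ℝ) (W S : ℝ → ℝ), IsMonatomicProfile r W S → CavityTube r W S → ∀ (X R₀ : ℝ), 0 < X → ∃ Cc : ℝ, 0 < Cc ∧ ∀ Λ : ℂ, ‖Λ‖ ≤ R₀ → ∀ (f g : ℝ → ℂ), IsRegularPair f g → ∀ N : ℝ, (∀ y : ℝ, y ≤ -X → ‖f y‖ + Real.exp y * ‖g y‖ ≤ N) → ∀ c₀ : ℂ, ∃ ŵ ŝ : ℝ → ℂ, IsRegularPair ŵ ŝ ∧ (∀ x ∈ Set.Iic (-X), Λ * ŵ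 x - linW r W S ŵ ŝ x = f x ∧ Λ * ŝ x - linS r W S ŵ ŝ x = g x) ∧ Tendsto (fun y : ℝ => (Real.exp y : ℂ) * ŝ y) atBot (𝓝 c₀) ∧ ∀ y : ℝ, y ≤ -X → ‖ŵ y‖ + Real.exp y * ‖ŝ y‖ ≤ Cc * (‖c₀‖ + N) := by
  intro r W S hP hT X R₀ hX
  have hW : ContDiff ℝ ∞ W := hP.2.2.1
  have hS : ContDiff ℝ ∞ S := hP.2.2.2.1
  have hnc0 := noncharacteristic_of_neg hP hT
  -- the uniform branch in the signed radius
  obtain ⟨δ₁, hδ₁, K, hK, hbr⟩ := centre_R_branch_uniform r W S hP R₀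
  set δ : ℝ := min δ₁ (2 * Real.exp (-X)) with hδ
  have hδpos : 0 < δ := lt_min hδ₁ (by positivity)
  have hδδ₁ : δ ≤ δ₁ := min_le_left _ _
  set L : ℝ := Real.log (δ / 2) with hL
  have hexpL' : Real.exp L = δ / 2 := by rw [hL, Real.exp_log (by positivity)]
  have hLX : L ≤ -X := by
    have h1 : δ / 2 ≤ Real.exp (-X) := by have := min_le_right δ₁ (2 * Real.exp (-X)); rw [hδ]; linarith
    calc L ≤ Real.log (Real.exp (-X)) := Real.log_le_log (by positivity) h1
      _ = -X := Real.log_exp _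
  have hexpL : ∀ y, y < L → Real.exp y < δ / 2 := fun y hy => by rw [← hexpL']; exact Real.exp_lt_exp.2 hy
  -- the transport constant on the fixed segment `[L − 1, −X]`
  have hncI : ∀ {a b : ℝ}, b < 0 → ∀ x ∈ Icc a b, W x + S x ≠ 1 ∧ W x - S x ≠ 1 := by
    intro a b hb x hx
    obtain ⟨h1, h2⟩ := hnc0 x (lt_of_le_of_lt hx.2 hb)
    exact ⟨fun h => h1 (by linarith), fun h => h2 (by linarith)⟩
  obtain ⟨KT, hKT, htrans⟩ := transport_segment r W S hP (L - 1) (-X) (by linarith) (hncI (by linarith))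
  -- the constant
  set x₀ : ℝ := L - 1 / 2 with hx₀
  set E₀ : ℝ := Real.exp (-x₀) with hE₀
  set EL : ℝ := Real.exp (1 - L) with hEL
  set Cc : ℝ := K + KT * Real.exp (KT * R₀) * ((1 + E₀) * K + EL) + 1 with hCc
  have hE₀1 : 1 ≤ E₀ := by rw [hE₀]; exact Real.one_le_exp (by rw [hx₀]; linarith)
  have hEL0 : 0 < EL := by rw [hEL]; exact Real.exp_pos _
  have hmid : 0 ≤ KT * Real.exp (KT * R₀) * ((1 + E₀) * K + EL) :=
    mul_nonneg (mul_nonneg hKT.le (Real.exp_pos _).le) (by nlinarith)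
  have hCcK : K ≤ Cc := by rw [hCc]; linarith
  refine ⟨Cc, by rw [hCc]; linarith, fun Λ hΛ f g hfg N hN c₀ => ?_⟩
  have hf : ContDiff ℝ ∞ f := hfg.1
  have hg : ContDiff ℝ ∞ g := hfg.2.1
  have hN0 : 0 ≤ N := (by positivity : (0 : ℝ) ≤ ‖f (-X)‖ + Real.exp (-X) * ‖g (-X)‖).trans (hN (-X) le_rfl)
  obtain ⟨u, c, hus, hcs, huce, hc0, hsol, hbound⟩ := hbr Λ hΛ f g hfg c₀
  -- the weighted bound of the branch on `eʸ ≤ δ/2`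
  have hR₁ : 0 < δ / 2 := by positivity
  have hR₁δ : δ / 2 < δ₁ := by linarith
  have hbd : ∀ y : ℝ, Real.exp y ≤ δ / 2 → ‖u (Real.exp y)‖ + ‖c (Real.exp y)‖ ≤ K * (‖c₀‖ + N) :=
    hbound (δ / 2) N hR₁ hR₁δ fun y hy => hN y (by
      have h1 : Real.exp y ≤ Real.exp (-X) := hy.trans (by
        have := min_le_right δ₁ (2 * Real.exp (-X)); rw [hδ]; linarith)
      exact Real.exp_le_exp.1 h1)
  -- even smooth extensions agreeing on `[−δ/2, δ/2]`, and the germ pair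
  have husδ : ContDiffOn ℝ ∞ u (Ioo (-δ) δ) := hus.mono (Ioo_subset_Ioo (by linarith) hδδ₁)
  have hcsδ : ContDiffOn ℝ ∞ c (Ioo (-δ) δ) := hcs.mono (Ioo_subset_Ioo (by linarith) hδδ₁)
  have hsubδ : Ioo (-δ) δ ⊆ Ioo (-δ₁) δ₁ := Ioo_subset_Ioo (by linarith) hδδ₁
  obtain ⟨ut, hut, hute, hutu⟩ := exists_even_contDiff_eq_of_evenOn hδpos husδ fun R hR => (huce R (hsubδ hR)).1
  obtain ⟨ct, hct, hcte, hctc⟩ := exists_even_contDiff_eq_of_evenOn hδpos hcsδ fun R hR => (huce R (hsubδ hR)).2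
  set ŵ₀ : ℝ → ℂ := fun y => ut (Real.exp y) with hŵ₀
  set ŝ₀ : ℝ → ℂ := fun y => (Real.exp (-y) : ℂ) * ct (Real.exp y) with hŝ₀
  have hŵ₀s : ContDiff ℝ ∞ ŵ₀ := hut.comp Real.contDiff_exp
  have hŝ₀s : ContDiff ℝ ∞ ŝ₀ :=
    (Complex.ofRealCLM.contDiff.comp (Real.contDiff_exp.comp contDiff_neg)).mul (hct.comp Real.contDiff_exp)
  have hutval : ∀ y, y < L → ut (Real.exp y) = u (Real.exp y) := fun y hy =>
    hutu _ (by rw [abs_of_pos (Real.exp_pos y)]; exact (hexpL y hy).le)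
  have hctval : ∀ y, y < L → ct (Real.exp y) = c (Real.exp y) := fun y hy =>
    hctc _ (by rw [abs_of_pos (Real.exp_pos y)]; exact (hexpL y hy).le)
  have hagreeW : EqOn ŵ₀ (fun y => u (Real.exp y)) (Iio L) := fun y hy => by simp only [hŵ₀]; exact hutval y hy
  have hagreeS : EqOn ŝ₀ (fun y => (Real.exp (-y) : ℂ) * c (Real.exp y)) (Iio L) := fun y hy => by
    simp only [hŝ₀]; rw [hctval y hy]
  have hsol₀ : ∀ x ∈ Iio L, Λ * ŵ₀ x - linW r W S ŵ₀ ŝ₀ x = f x ∧ Λ * ŝ₀ x - linS r W S ŵ₀ ŝ₀ x = g x := by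
    intro x hx
    have gw := hagreeW.eventuallyEq_of_mem (Iio_mem_nhds hx)
    have gs := hagreeS.eventuallyEq_of_mem (Iio_mem_nhds hx)
    obtain ⟨h1, h2⟩ := lin_congr_of_eventuallyEq (r := r) (W := W) (S := S) gw gs
    rw [h1, h2, gw.eq_of_nhds, gs.eq_of_nhds]
    exact hsol x (lt_of_lt_of_le (by linarith [hexpL x hx]) hδδ₁)
  have hreg₀ : IsRegularPair ŵ₀ ŝ₀ := by
    obtain ⟨hF₁, hF₂, -, -⟩ := contDiff_radial_fields_of_even hut hute
    obtain ⟨-, -, hG₁, hG₂⟩ := contDiff_radial_fields_of_even hct hcte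
    refine ⟨hŵ₀s, hŝ₀s, fun y => (ut ‖y‖).re • y, fun y => (ut ‖y‖).im • y, fun y => (ct ‖y‖).re,
      fun y => (ct ‖y‖).im, hF₁, hF₂, hG₁, hG₂, fun y hy => ?_⟩
    have hny : 0 < ‖y‖ := norm_pos_iff.2 hy
    have he : Real.exp (Real.log ‖y‖) = ‖y‖ := Real.exp_log hny
    have he' : (Real.exp (-Real.log ‖y‖) : ℂ) = ((‖y‖⁻¹ : ℝ) : ℂ) := by rw [Real.exp_neg, he]
    refine ⟨?_, ?_, ?_, ?_⟩
    · simp only [hŵ₀, he]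
    · simp only [hŵ₀, he]
    · simp only [hŝ₀, he, he', Complex.re_ofReal_mul]; field_simp
    · simp only [hŝ₀, he, he', Complex.im_ofReal_mul]; field_simp
  -- the weighted bound of the germ pair on `y < L`
  have hbd₀ : ∀ y, y < L → ‖ŵ₀ y‖ + Real.exp y * ‖ŝ₀ y‖ ≤ K * (‖c₀‖ + N) := by
    intro y hy
    have e1 : ‖ŵ₀ y‖ = ‖u (Real.exp y)‖ := by rw [hagreeW hy]
    have e2 : Real.exp y * ‖ŝ₀ y‖ = ‖c (Real.exp y)‖ := by
      rw [hagreeS hy]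
      simp only []
      rw [norm_mul, Complex.norm_real, Real.norm_eq_abs, abs_of_pos (Real.exp_pos _), ← mul_assoc, ← Real.exp_add]
      simp
    rw [e1, e2]
    exact hbd y (hexpL y hy).le
  -- the regular transport on `[L − 1, −X/2]` through the datum at `x₀ = L − 1/2`, and the glue
  have hab : L - 1 < -X / 2 := by linarith
  obtain ⟨ŵ₁, ŝ₁, hŵ₁s, hŝ₁s, hd₁, hŵ₁0, hŝ₁0, hsol₁⟩ := exists_solution_segment (r := r) hW hS hab
    (fun x hx => hnc0 x (by linarith [hx.2])) Λ hf hg x₀ (ŵ₀ x₀) (ŝ₀ x₀)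
  obtain ⟨U, V, hU, hV, hsolU, eU, eV, eU', eV'⟩ := glue_solutions r W S hW hS Λ f g ŵ₀ ŝ₀ ŵ₁ ŝ₁ (L - 1) x₀ L (-X / 2)
    (by rw [hx₀]; linarith) (by rw [hx₀]; linarith) (by linarith) (fun x hx => hnc0 x (by linarith [hx.2, hLX]))
    hŵ₀s.contDiffOn hŝ₀s.contDiffOn hŵ₁s hŝ₁s hsol₀ (fun x hx => hsol₁ x (Ioo_subset_Icc_self hx)) hŵ₁0.symm hŝ₁0.symm
  obtain ⟨ŵ, ŝ, hreg, hsolw, ew, es⟩ := regularize_cutoff (b := -X / 2) (b' := -X) (m := L) (by linarith) hreg₀ hU hV eU eV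
    hsolU
  -- the transport estimate on `[L − 1, −X]`
  have hx₀I : x₀ ∈ Icc (L - 1) (-X) := ⟨by rw [hx₀]; linarith, by rw [hx₀]; linarith⟩
  have hM : ∀ x ∈ Icc (L - 1) (-X), ‖f x‖ + ‖g x‖ ≤ EL * N := by
    intro x hx
    have hNx := hN x hx.2
    have hex : Real.exp (-x) ≤ EL := by rw [hEL]; exact Real.exp_le_exp.2 (by linarith [hx.1])
    have hex1 : 1 ≤ Real.exp (-x) := Real.one_le_exp (by linarith [hx.2])
    have hgx : Real.exp (-x) * (‖f x‖ + Real.exp x * ‖g x‖) = Real.exp (-x) * ‖f x‖ + ‖g x‖ := by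
      rw [mul_add, ← mul_assoc, ← Real.exp_add]; simp
    have h1 : ‖f x‖ + ‖g x‖ ≤ Real.exp (-x) * (‖f x‖ + Real.exp x * ‖g x‖) := by
      rw [hgx]; nlinarith [mul_nonneg (sub_nonneg.2 hex1) (norm_nonneg (f x))]
    calc ‖f x‖ + ‖g x‖ ≤ Real.exp (-x) * (‖f x‖ + Real.exp x * ‖g x‖) := h1
      _ ≤ EL * N := mul_le_mul hex hNx (by positivity) (by positivity)
  have htr := (htrans Λ f g hf hg).2 ŵ₁ ŝ₁ (EL * N) (fun x _ => hd₁ x)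
    (fun x hx => hsol₁ x ⟨hx.1, by linarith [hx.2]⟩) hM x₀ hx₀I
  have hdat : ‖ŵ₁ x₀‖ + ‖ŝ₁ x₀‖ ≤ (1 + E₀) * K * (‖c₀‖ + N) := by
    have hx₀L : x₀ < L := by rw [hx₀]; linarith
    have hb := hbd₀ x₀ hx₀L
    rw [hŵ₁0, hŝ₁0]
    have hpos : 0 < Real.exp x₀ := Real.exp_pos _
    have hs : ‖ŝ₀ x₀‖ = E₀ * (Real.exp x₀ * ‖ŝ₀ x₀‖) := by
      rw [hE₀, ← mul_assoc, ← Real.exp_add]; simp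
    have hw0 : 0 ≤ ‖ŵ₀ x₀‖ := norm_nonneg _
    have hs0 : 0 ≤ Real.exp x₀ * ‖ŝ₀ x₀‖ := by positivity
    rw [hs]
    nlinarith
  have hexpK : Real.exp (KT * |Λ.re|) ≤ Real.exp (KT * R₀) :=
    Real.exp_le_exp.2 (mul_le_mul_of_nonneg_left ((Complex.abs_re_le_norm Λ).trans hΛ) hKT.le)
  have hbd₁ : ∀ y ∈ Icc (L - 1) (-X), ‖ŵ₁ y‖ + ‖ŝ₁ y‖ ≤ KT * Real.exp (KT * R₀) * ((1 + E₀) * K + EL) * (‖c₀‖ + N) := by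
    intro y hy
    have h := htr y hy
    have h2 : ‖ŵ₁ x₀‖ + ‖ŝ₁ x₀‖ + EL * N ≤ ((1 + E₀) * K + EL) * (‖c₀‖ + N) := by
      nlinarith [hdat, norm_nonneg c₀, Real.exp_pos (1 - L)]
    calc ‖ŵ₁ y‖ + ‖ŝ₁ y‖ ≤ KT * Real.exp (KT * |Λ.re|) * (‖ŵ₁ x₀‖ + ‖ŝ₁ x₀‖ + EL * N) := h
      _ ≤ KT * Real.exp (KT * R₀) * (((1 + E₀) * K + EL) * (‖c₀‖ + N)) := by
          have h0 : (0 : ℝ) ≤ ‖ŵ₁ x₀‖ + ‖ŝ₁ x₀‖ + EL * N := by positivity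
          exact mul_le_mul (mul_le_mul_of_nonneg_left hexpK hKT.le) h2 h0 (by positivity)
      _ = KT * Real.exp (KT * R₀) * ((1 + E₀) * K + EL) * (‖c₀‖ + N) := by ring
  refine ⟨ŵ, ŝ, hreg, hsolw, ?_, fun y hy => ?_⟩
  · -- the centre normalisation `eʸ ŝ(y) = ct(eʸ) → ct(0) = c(0) = c₀`
    have hlim : Tendsto (fun y : ℝ => ct (Real.exp y)) atBot (𝓝 (ct 0)) :=
      (hct.continuous.tendsto 0).comp Real.tendsto_exp_atBot
    have hct0 : ct 0 = c₀ := by rw [hctc 0 (by simp; positivity), hc0]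
    rw [hct0] at hlim
    refine hlim.congr' ?_
    filter_upwards [Iio_mem_atBot (min L (-X))] with y hy
    have hyL : y < L := lt_of_lt_of_le hy (min_le_left _ _)
    have hyX : y ∈ Iic (-X) := show y ≤ -X from (lt_of_lt_of_le hy (min_le_right _ _)).le
    rw [es hyX, eV hyL]
    simp only [hŝ₀]
    rw [← mul_assoc, ← Complex.ofReal_mul, ← Real.exp_add]
    simp
  · -- the weighted bound on `y ≤ −X`
    have hyX : y ∈ Iic (-X) := hy
    rw [ew hyX, es hyX]
    have hc₀N : 0 ≤ ‖c₀‖ + N := by positivity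
    rcases lt_or_ge y L with hyL | hyL
    · rw [eU hyL, eV hyL]
      exact (hbd₀ y hyL).trans (mul_le_mul_of_nonneg_right hCcK hc₀N)
    · have hyI : y ∈ Ioo (L - 1) (-X / 2) := ⟨by linarith, by linarith⟩
      rw [eU' hyI, eV' hyI]
      have hey : Real.exp y ≤ 1 := Real.exp_le_one_iff.2 (by linarith)
      calc ‖ŵ₁ y‖ + Real.exp y * ‖ŝ₁ y‖ ≤ ‖ŵ₁ y‖ + ‖ŝ₁ y‖ := by
            nlinarith [norm_nonneg (ŝ₁ y)]
        _ ≤ KT * Real.exp (KT * R₀) * ((1 + E₀) * K + EL) * (‖c₀‖ + N) := hbd₁ y ⟨by linarith, hy⟩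
        _ ≤ Cc * (‖c₀‖ + N) := by
            refine mul_le_mul_of_nonneg_right ?_ hc₀N
            rw [hCc]; nlinarith [hK, Real.exp_pos (KT * R₀)]

end Summit.AtomisticToContinuum.HydrodynamicLimit.Theorems.SonicCavityRenewal

end
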